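import Summits.QuantumFields.YangMills.Theorems.CurvaturePoincareAxialLadderSums
import Literature.MathematicalPhysics.QuantumFieldTheory.Balaban1983to89.T3ContinuumYM3Torus
import Mathlib.Algebra.Order.Chebyshev
import HarnessLib

/-!
# LINE 30 «CurvaturePoincare» — the box Uhlenbeck lemma, torus side I: box coordinates of bonds, ROOTED axial gauges, per-direction squared bond sums

Crux of record `PoincareLipschitz.MesoscopicConcentrationL` (stmt-QuantumFields-23532; LINE 30 skeleton `Cruxes/HistoryTailL/Lines/curvature_poincare.lean`
sha16 e95b7bfb5ac8bc91, NP sub-plan `…/curvature_poincare_planNP.lean`, ideator ym-r3-idea-2 g16); cell `ym3-torus` (YM ladder rung R3 = continuum `SU(2)`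
Yang–Mills on T³ — a RUNG, NOT the Clay problem); width seat `ym3-torus-px19` gen 9 (NP pen of record, ★★OWNER WORD 43).  Second of three NP files:
`CurvaturePoincareAxialLadderSums` (group level) → THIS → `CurvaturePoincareBoxUhlenbeck` (line sums into `boxPlaqs`, average over roots, planNP's `stub_boxUhlenbeck`).
WHAT IS PROVED (member `F.P K`, `d = 3` by `rfl`; any `[GaugeGroup G]`): §0 order ∕ coordinate rows for the points `lo + a·e₀ + b·e₁ + c·e₂` of an integer box
(literal `Fin 3`, transported to `Fin (F.P K).d` by `exact`); §1 `bond_coords` (a bond with both ends in the `ZMod` box of side `n` at `x₀` starts at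
`castSite (lo + v₀e₀ + v₁e₁ + v₂e₂)`, `v_k = (b.src k − x₀ k).val ≤ n − 1`, `v_dir + 1 ≤ n − 1`), `exists_rooted_gauge` ∕ `gaugeAct_castSite_of_root` (for EVERY root
`y` the axial gauge `axialFn (pull U) y` descends to a torus gauge transformation acting on box bonds by the `ℤ³` gauge action — the corner-rooted case is
`T4AxialGaugeSmallField.axialGauge`), the per-direction bounds of the group-level file on torus bonds, and for the root `lo + r·e₀` the SQUARED SUMS over the
direction-`1` ∕ direction-`2` bonds of the box: `≤ n(n−1)·S₀₁` and `≤ 2(n−1)·(n²·S₁₂(r) + n·S₀₂)` (`S..` = sums of `dist₁(U(∂p))²` over coordinate LINES of box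
plaquettes by integer offsets; Cauchy–Schwarz `sq_sum_le_card_mul_sum_sq`, injection `b ↦ ((b.src k − x₀ k).val)_k` into `range n ×ˢ range n ×ˢ range n`,
`Finset.sum_product`).  The `n²` in front of `S₁₂(r)` is the congestion of ONE root's spine plane — the next file averages it away.
HONEST SCOPE.  Bookkeeping; proves nothing of `stub_boxUhlenbeck` ∕ NP by itself, nothing of LM ∕ B♯ ∕ MD, K1 (23532), 23083, 19936, 19200, 20520 or rung R3;
R3 = continuum `SU(2)` YM on T³ — NOT d = 4, NOT infinite volume, NOT a mass gap, NOT Clay.  THEOREMS ONLY (0 `def`, 0 `sorry`); `--supports stmt-QuantumFields-23532`.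
References: M. Creutz, «Quarks, gluons and lattices» (1983) ch. 9 [folklore]; T. Bałaban, CMP 98 (1985) pp. 24–25 [Balaban1985Averaging].
-/

set_option autoImplicit false

open scoped BigOperators
open Literature.MathematicalPhysics.QuantumFieldTheory.Balaban1983to89
open Literature.MathematicalPhysics.QuantumFieldTheory.Balaban1983to89.T3ContinuumYM3Torus
open Literature.MathematicalPhysics.QuantumFieldTheory.Balaban1983to89.T4AxialGaugeSmallField
  (castSite castSite_apply castSite_add_e pull pull_apply castSite_injOn_box)
open Literature.MathematicalPhysics.QuantumFieldTheory.Balaban1983to89.B7Prop1Explicit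
  (e e_apply hol gaugeAct plaqWord axialFn)
open Literature.MathematicalPhysics.QuantumFieldTheory.Balaban1983to89.B8Lemma1NonAbelian (e_nonneg zsmul_e_apply)
open Summit.QuantumFields.YangMills.Theorems.CurvaturePoincareAxialLadderSums
  (axial_bond_zero_eq_one dist1_axial_bond_one_le dist1_axial_bond_two_le)

namespace Summit.QuantumFields.YangMills.Theorems.CurvaturePoincareBoxBonds

/-! ## §0 Points of a three-dimensional integer box (literal `Fin 3` = `Fin (F.P K).d` by `T3Family.P_d`) -/

section Points

variable (lo : B7Prop1Explicit.Site 3)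

/-- Coordinate `0` of `lo + a·e₀ + b·e₁ + c·e₂`. [folklore] -/
theorem pt3_apply_zero (a b c : ℤ) : (lo + a • e 0 + b • e 1 + c • e 2 : B7Prop1Explicit.Site 3) 0 = lo 0 + a := by
  simp [e_apply]

/-- Coordinate `1` of `lo + a·e₀ + b·e₁ + c·e₂`. [folklore] -/
theorem pt3_apply_one (a b c : ℤ) : (lo + a • e 0 + b • e 1 + c • e 2 : B7Prop1Explicit.Site 3) 1 = lo 1 + b := by
  simp [e_apply]

/-- Coordinate `2` of `lo + a·e₀ + b·e₁ + c·e₂`. [folklore] -/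
theorem pt3_apply_two (a b c : ℤ) : (lo + a • e 0 + b • e 1 + c • e 2 : B7Prop1Explicit.Site 3) 2 = lo 2 + c := by
  simp [e_apply]

/-- The corner is below every box point. [folklore] -/
theorem le_pt3 (a b c : ℕ) : lo ≤ lo + (a : ℤ) • e 0 + (b : ℤ) • e 1 + (c : ℤ) • e 2 := by
  intro k
  fin_cases k <;> simp [e_apply]

/-- A box point is below the top corner `lo + N·(1,1,1)`. [folklore] -/
theorem pt3_le {N a b c : ℕ} (ha : a ≤ N) (hb : b ≤ N) (hc : c ≤ N) :
    lo + (a : ℤ) • e 0 + (b : ℤ) • e 1 + (c : ℤ) • e 2 ≤ fun k => lo k + (N : ℤ) := by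
  intro k
  fin_cases k <;> simp [e_apply] <;> omega

/-- The far end of a direction-`0` bond of the box. [folklore] -/
theorem pt3_add_e_zero_le {N a b c : ℕ} (ha : a + 1 ≤ N) (hb : b ≤ N) (hc : c ≤ N) :
    lo + (a : ℤ) • e 0 + (b : ℤ) • e 1 + (c : ℤ) • e 2 + e 0 ≤ fun k => lo k + (N : ℤ) := by
  intro k
  fin_cases k <;> simp [e_apply] <;> omega

/-- The far end of a direction-`1` bond of the box. [folklore] -/
theorem pt3_add_e_one_le {N a b c : ℕ} (ha : a ≤ N) (hb : b + 1 ≤ N) (hc : c ≤ N) :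
    lo + (a : ℤ) • e 0 + (b : ℤ) • e 1 + (c : ℤ) • e 2 + e 1 ≤ fun k => lo k + (N : ℤ) := by
  intro k
  fin_cases k <;> simp [e_apply] <;> omega

/-- The far end of a direction-`2` bond of the box. [folklore] -/
theorem pt3_add_e_two_le {N a b c : ℕ} (ha : a ≤ N) (hb : b ≤ N) (hc : c + 1 ≤ N) :
    lo + (a : ℤ) • e 0 + (b : ℤ) • e 1 + (c : ℤ) • e 2 + e 2 ≤ fun k => lo k + (N : ℤ) := by
  intro k
  fin_cases k <;> simp [e_apply] <;> omega

/-- The far corner of a `(0,1)`-plaquette of the box. [folklore] -/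
theorem pt3_add_e_zero_add_e_one_le {N a b c : ℕ} (ha : a + 1 ≤ N) (hb : b + 1 ≤ N) (hc : c ≤ N) :
    lo + (a : ℤ) • e 0 + (b : ℤ) • e 1 + (c : ℤ) • e 2 + e 0 + e 1 ≤ fun k => lo k + (N : ℤ) := by
  intro k
  fin_cases k <;> simp [e_apply] <;> omega

/-- The far corner of a `(1,2)`-plaquette of the box. [folklore] -/
theorem pt3_add_e_one_add_e_two_le {N a b c : ℕ} (ha : a ≤ N) (hb : b + 1 ≤ N) (hc : c + 1 ≤ N) :
    lo + (a : ℤ) • e 0 + (b : ℤ) • e 1 + (c : ℤ) • e 2 + e 1 + e 2 ≤ fun k => lo k + (N : ℤ) := by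
  intro k
  fin_cases k <;> simp [e_apply] <;> omega

/-- The far corner of a `(0,2)`-plaquette of the box. [folklore] -/
theorem pt3_add_e_zero_add_e_two_le {N a b c : ℕ} (ha : a + 1 ≤ N) (hb : b ≤ N) (hc : c + 1 ≤ N) :
    lo + (a : ℤ) • e 0 + (b : ℤ) • e 1 + (c : ℤ) • e 2 + e 0 + e 2 ≤ fun k => lo k + (N : ℤ) := by
  intro k
  fin_cases k <;> simp [e_apply] <;> omega

end Points

/-! ## §1 Torus side for the member `F.P K` (`Fin (F.P K).d` is `Fin 3` by `rfl`: the §0 rows transport by `exact`) -/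

section Member

variable (F : T3Family) (K : ℕ) {G : Type*} [GaugeGroup G]

/-- `le_pt3` for the member's index type. [folklore] -/
theorem le_ptP (lo : Fin (F.P K).d → ℤ) (a b c : ℕ) : lo ≤ lo + (a : ℤ) • e 0 + (b : ℤ) • e 1 + (c : ℤ) • e 2 :=
  le_pt3 lo a b c

/-- `pt3_le` for the member's index type. [folklore] -/
theorem ptP_le (lo : Fin (F.P K).d → ℤ) {N a b c : ℕ} (ha : a ≤ N) (hb : b ≤ N) (hc : c ≤ N) :
    lo + (a : ℤ) • e 0 + (b : ℤ) • e 1 + (c : ℤ) • e 2 ≤ fun k => lo k + (N : ℤ) :=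
  pt3_le lo ha hb hc

/-- `pt3_add_e_zero_le` for the member's index type. [folklore] -/
theorem ptP_add_e_zero_le (lo : Fin (F.P K).d → ℤ) {N a b c : ℕ} (ha : a + 1 ≤ N) (hb : b ≤ N) (hc : c ≤ N) :
    lo + (a : ℤ) • e 0 + (b : ℤ) • e 1 + (c : ℤ) • e 2 + e 0 ≤ fun k => lo k + (N : ℤ) :=
  pt3_add_e_zero_le lo ha hb hc

/-- `pt3_add_e_one_le` for the member's index type. [folklore] -/
theorem ptP_add_e_one_le (lo : Fin (F.P K).d → ℤ) {N a b c : ℕ} (ha : a ≤ N) (hb : b + 1 ≤ N) (hc : c ≤ N) :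
    lo + (a : ℤ) • e 0 + (b : ℤ) • e 1 + (c : ℤ) • e 2 + e 1 ≤ fun k => lo k + (N : ℤ) :=
  pt3_add_e_one_le lo ha hb hc

/-- `pt3_add_e_two_le` for the member's index type. [folklore] -/
theorem ptP_add_e_two_le (lo : Fin (F.P K).d → ℤ) {N a b c : ℕ} (ha : a ≤ N) (hb : b ≤ N) (hc : c + 1 ≤ N) :
    lo + (a : ℤ) • e 0 + (b : ℤ) • e 1 + (c : ℤ) • e 2 + e 2 ≤ fun k => lo k + (N : ℤ) :=
  pt3_add_e_two_le lo ha hb hc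

/-- `pt3_add_e_zero_add_e_one_le` for the member's index type. [folklore] -/
theorem ptP_add_e_zero_add_e_one_le (lo : Fin (F.P K).d → ℤ) {N a b c : ℕ} (ha : a + 1 ≤ N) (hb : b + 1 ≤ N) (hc : c ≤ N) :
    lo + (a : ℤ) • e 0 + (b : ℤ) • e 1 + (c : ℤ) • e 2 + e 0 + e 1 ≤ fun k => lo k + (N : ℤ) :=
  pt3_add_e_zero_add_e_one_le lo ha hb hc

/-- `pt3_add_e_one_add_e_two_le` for the member's index type. [folklore] -/
theorem ptP_add_e_one_add_e_two_le (lo : Fin (F.P K).d → ℤ) {N a b c : ℕ} (ha : a ≤ N) (hb : b + 1 ≤ N) (hc : c + 1 ≤ N) :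
    lo + (a : ℤ) • e 0 + (b : ℤ) • e 1 + (c : ℤ) • e 2 + e 1 + e 2 ≤ fun k => lo k + (N : ℤ) :=
  pt3_add_e_one_add_e_two_le lo ha hb hc

/-- `pt3_add_e_zero_add_e_two_le` for the member's index type. [folklore] -/
theorem ptP_add_e_zero_add_e_two_le (lo : Fin (F.P K).d → ℤ) {N a b c : ℕ} (ha : a + 1 ≤ N) (hb : b ≤ N) (hc : c + 1 ≤ N) :
    lo + (a : ℤ) • e 0 + (b : ℤ) • e 1 + (c : ℤ) • e 2 + e 0 + e 2 ≤ fun k => lo k + (N : ℤ) :=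
  pt3_add_e_zero_add_e_two_le lo ha hb hc

/-- `pt3_apply_zero` for the member's index type. [folklore] -/
theorem ptP_apply_zero (lo : Fin (F.P K).d → ℤ) (a b c : ℤ) :
    (lo + a • e 0 + b • e 1 + c • e 2 : Fin (F.P K).d → ℤ) 0 = lo 0 + a :=
  pt3_apply_zero lo a b c

/-- `pt3_apply_one` for the member's index type. [folklore] -/
theorem ptP_apply_one (lo : Fin (F.P K).d → ℤ) (a b c : ℤ) :
    (lo + a • e 0 + b • e 1 + c • e 2 : Fin (F.P K).d → ℤ) 1 = lo 1 + b :=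
  pt3_apply_one lo a b c

/-- `pt3_apply_two` for the member's index type. [folklore] -/
theorem ptP_apply_two (lo : Fin (F.P K).d → ℤ) (a b c : ℤ) :
    (lo + a • e 0 + b • e 1 + c • e 2 : Fin (F.P K).d → ℤ) 2 = lo 2 + c :=
  pt3_apply_two lo a b c

/-- **Box coordinates of a bond.**  A bond with both ends in the `ZMod` box of side `n` at `x₀` (`1 ≤ n`, `2n ≤ sitesPerDir 0`) has integer offsets
`v_k = (b.src k − x₀ k).val ≤ n − 1`, `v_{dir} + 1 ≤ n − 1` (no wrap-around since `2n ≤ sitesPerDir`), and starts at `castSite (lo + v₀e₀ + v₁e₁ + v₂e₂)`,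
`lo = x₀.val`. [folklore] -/
theorem bond_coords {n : ℕ} (hn : 1 ≤ n) (h2n : 2 * n ≤ (F.P K).sitesPerDir 0) (x₀ : Site (F.P K) 0) (b : PBond (F.P K) 0)
    (hs : ∀ k, (b.src k - x₀ k).val < n) (ht : ∀ k, (b.tgt k - x₀ k).val < n) :
    (∀ k, (b.src k - x₀ k).val ≤ n - 1) ∧ (b.src b.dir - x₀ b.dir).val + 1 ≤ n - 1 ∧
      b.src = castSite ((fun k => ((x₀ k).val : ℤ)) + (((b.src 0 - x₀ 0).val : ℕ) : ℤ) • e 0 +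
        (((b.src 1 - x₀ 1).val : ℕ) : ℤ) • e 1 + (((b.src 2 - x₀ 2).val : ℕ) : ℤ) • e 2) := by
  refine ⟨fun k => by have := hs k; omega, ?_, ?_⟩
  · have h1 := hs b.dir
    have h2 := ht b.dir
    have htgt : b.tgt b.dir - x₀ b.dir = (b.src b.dir - x₀ b.dir) + 1 := by
      simp only [PBond.tgt, Site.shift, Function.update_self]
      ring
    rw [htgt, ZMod.val_add, ZMod.val_one_eq_one_mod, Nat.add_mod_mod, Nat.mod_eq_of_lt (by omega)] at h2
    omega
  · funext k
    fin_cases k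
    · show b.src 0 = castSite ((fun k => ((x₀ k).val : ℤ)) + (((b.src 0 - x₀ 0).val : ℕ) : ℤ) • e 0 +
        (((b.src 1 - x₀ 1).val : ℕ) : ℤ) • e 1 + (((b.src 2 - x₀ 2).val : ℕ) : ℤ) • e 2) 0
      rw [castSite_apply, ptP_apply_zero]
      push_cast
      rw [ZMod.natCast_zmod_val, ZMod.natCast_zmod_val, add_sub_cancel]
    · show b.src 1 = castSite ((fun k => ((x₀ k).val : ℤ)) + (((b.src 0 - x₀ 0).val : ℕ) : ℤ) • e 0 +
        (((b.src 1 - x₀ 1).val : ℕ) : ℤ) • e 1 + (((b.src 2 - x₀ 2).val : ℕ) : ℤ) • e 2) 1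
      rw [castSite_apply, ptP_apply_one]
      push_cast
      rw [ZMod.natCast_zmod_val, ZMod.natCast_zmod_val, add_sub_cancel]
    · show b.src 2 = castSite ((fun k => ((x₀ k).val : ℤ)) + (((b.src 0 - x₀ 0).val : ℕ) : ℤ) • e 0 +
        (((b.src 1 - x₀ 1).val : ℕ) : ℤ) • e 1 + (((b.src 2 - x₀ 2).val : ℕ) : ℤ) • e 2) 2
      rw [castSite_apply, ptP_apply_two]
      push_cast
      rw [ZMod.natCast_zmod_val, ZMod.natCast_zmod_val, add_sub_cancel]

/-- **The rooted axial gauge acts on box bonds by the `ℤ³` gauge action.**  If `g` agrees on the image of the box `[lo, hi]` with `axialFn (pull U) y`, then on a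
bond `⟨castSite x, μ⟩` with both ends in the box `U^g = (pull U)^{axialFn y}` (the proof of `T4AxialGaugeSmallField.gaugeAct_axialGauge_castSite` for a general
root `y`). [folklore] -/
theorem gaugeAct_castSite_of_root (U : GaugeField (F.P K) 0 G) {lo hi : Fin (F.P K).d → ℤ} (y : Fin (F.P K).d → ℤ)
    (g : GaugeTransf (F.P K) 0 G) (hg : ∀ x, lo ≤ x → x ≤ hi → g (castSite x) = axialFn (pull U) y x)
    (x : Fin (F.P K).d → ℤ) (μ : Fin (F.P K).d) (hx : lo ≤ x) (hxμ : x + e μ ≤ hi) :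
    GaugeField.gaugeAct g U ⟨castSite x, μ⟩ = gaugeAct (axialFn (pull U) y) (pull U) x μ := by
  have hx' : x ≤ hi := (le_add_of_nonneg_right (e_nonneg μ)).trans hxμ
  have hlo' : lo ≤ x + e μ := hx.trans (le_add_of_nonneg_right (e_nonneg μ))
  simp only [GaugeField.gaugeAct, PBond.tgt, gaugeAct, pull_apply]
  rw [← castSite_add_e, hg x hx hx', hg (x + e μ) hlo' hxμ]

/-- **Rooted axial gauges exist on non-wrapping boxes**: for every root `y` there is a torus gauge transformation agreeing with `axialFn (pull U) y` on the image
of `[lo, hi]` (`castSite` is injective there; `1` off the box). [folklore] -/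
theorem exists_rooted_gauge (U : GaugeField (F.P K) 0 G) {lo hi : Fin (F.P K).d → ℤ} (hN : ∀ κ, hi κ - lo κ < (F.P K).sitesPerDir 0)
    (y : Fin (F.P K).d → ℤ) :
    ∃ g : GaugeTransf (F.P K) 0 G, ∀ x, lo ≤ x → x ≤ hi → g (castSite x) = axialFn (pull U) y x := by
  classical
  refine ⟨fun s => if h : ∃ x : Fin (F.P K).d → ℤ, lo ≤ x ∧ x ≤ hi ∧ (castSite x : Site (F.P K) 0) = s
    then axialFn (pull U) y (Classical.choose h) else 1, fun x hx hx' => ?_⟩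
  have h : ∃ x' : Fin (F.P K).d → ℤ, lo ≤ x' ∧ x' ≤ hi ∧ (castSite x' : Site (F.P K) 0) = castSite x := ⟨x, hx, hx', rfl⟩
  simp only [dif_pos h]
  obtain ⟨h1, h2, h3⟩ := Classical.choose_spec h
  rw [castSite_injOn_box hN h1 h2 hx hx' h3]

/-- DIRECTION 0 on the torus: every direction-`0` bond of the box is trivial in the rooted axial gauge. [folklore] -/
theorem gaugeAct_zero_eq_one (U : GaugeField (F.P K) 0 G) (lo : Fin (F.P K).d → ℤ) {N : ℕ} (r : ℕ) (g : GaugeTransf (F.P K) 0 G)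
    (hg : ∀ x, lo ≤ x → x ≤ (fun k => lo k + (N : ℤ)) → g (castSite x) = axialFn (pull U) (lo + (r : ℤ) • e 0) x)
    {v₀ v₁ v₂ : ℕ} (hv₀ : v₀ + 1 ≤ N) (hv₁ : v₁ ≤ N) (hv₂ : v₂ ≤ N) :
    GaugeField.gaugeAct g U ⟨castSite (lo + (v₀ : ℤ) • e 0 + (v₁ : ℤ) • e 1 + (v₂ : ℤ) • e 2), 0⟩ = 1 := by
  rw [gaugeAct_castSite_of_root F K U (lo + (r : ℤ) • e 0) g hg _ 0 (le_ptP F K lo v₀ v₁ v₂) (ptP_add_e_zero_le F K lo hv₀ hv₁ hv₂)]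
  exact axial_bond_zero_eq_one (pull U) _ _

/-- DIRECTION 1 on the torus: in the gauge rooted at `lo + r·e₀` the bond `⟨castSite (lo + v₀e₀ + v₁e₁ + v₂e₂), 1⟩` of the box `[lo, lo + N]` is bounded by the
`(0,1)`-plaquette line through it. [folklore] -/
theorem dist1_gaugeAct_one_le (U : GaugeField (F.P K) 0 G) (lo : Fin (F.P K).d → ℤ) {N r : ℕ} (hr : r ≤ N) (g : GaugeTransf (F.P K) 0 G)
    (hg : ∀ x, lo ≤ x → x ≤ (fun k => lo k + (N : ℤ)) → g (castSite x) = axialFn (pull U) (lo + (r : ℤ) • e 0) x)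
    {v₀ v₁ v₂ : ℕ} (hv₀ : v₀ ≤ N) (hv₁ : v₁ + 1 ≤ N) (hv₂ : v₂ ≤ N) :
    dist1 (GaugeField.gaugeAct g U ⟨castSite (lo + (v₀ : ℤ) • e 0 + (v₁ : ℤ) • e 1 + (v₂ : ℤ) • e 2), 1⟩) ≤
      ∑ t ∈ Finset.range N, dist1 (hol (pull U) (lo + (t : ℤ) • e 0 + (v₁ : ℤ) • e 1 + (v₂ : ℤ) • e 2) (plaqWord 0 1)) := by
  rw [gaugeAct_castSite_of_root F K U (lo + (r : ℤ) • e 0) g hg _ 1 (le_ptP F K lo v₀ v₁ v₂) (ptP_add_e_one_le F K lo hv₀ hv₁ hv₂)]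
  exact dist1_axial_bond_one_le (pull U) lo v₁ v₂ hr hv₀

/-- DIRECTION 2 on the torus: the bond `⟨castSite (lo + v₀e₀ + v₁e₁ + v₂e₂), 2⟩` is bounded by the `(1,2)`-line of the spine plane `x₀ = lo₀ + r` plus the
`(0,2)`-line through it. [folklore] -/
theorem dist1_gaugeAct_two_le (U : GaugeField (F.P K) 0 G) (lo : Fin (F.P K).d → ℤ) {N r : ℕ} (hr : r ≤ N) (g : GaugeTransf (F.P K) 0 G)
    (hg : ∀ x, lo ≤ x → x ≤ (fun k => lo k + (N : ℤ)) → g (castSite x) = axialFn (pull U) (lo + (r : ℤ) • e 0) x)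
    {v₀ v₁ v₂ : ℕ} (hv₀ : v₀ ≤ N) (hv₁ : v₁ ≤ N) (hv₂ : v₂ + 1 ≤ N) :
    dist1 (GaugeField.gaugeAct g U ⟨castSite (lo + (v₀ : ℤ) • e 0 + (v₁ : ℤ) • e 1 + (v₂ : ℤ) • e 2), 2⟩) ≤
      (∑ s ∈ Finset.range N, dist1 (hol (pull U) (lo + (r : ℤ) • e 0 + (s : ℤ) • e 1 + (v₂ : ℤ) • e 2) (plaqWord 1 2))) +
        ∑ t ∈ Finset.range N, dist1 (hol (pull U) (lo + (t : ℤ) • e 0 + (v₁ : ℤ) • e 1 + (v₂ : ℤ) • e 2) (plaqWord 0 2)) := by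
  rw [gaugeAct_castSite_of_root F K U (lo + (r : ℤ) • e 0) g hg _ 2 (le_ptP F K lo v₀ v₁ v₂) (ptP_add_e_two_le F K lo hv₀ hv₁ hv₂)]
  exact dist1_axial_bond_two_le (pull U) lo v₂ hr hv₀ hv₁

/-- The coordinate map `b ↦ ((b.src k − x₀ k).val)_{k = 0,1,2}` is injective on bonds of a fixed direction. [folklore] -/
theorem injOn_bond_coords (x₀ : Site (F.P K) 0) (B : Finset (PBond (F.P K) 0)) {μ : Fin (F.P K).d} (hB : ∀ b ∈ B, b.dir = μ) :
    Set.InjOn (fun b : PBond (F.P K) 0 => ((b.src 0 - x₀ 0).val, (b.src 1 - x₀ 1).val, (b.src 2 - x₀ 2).val)) B := by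
  intro b hb b' hb' h
  simp only [Prod.mk.injEq] at h
  obtain ⟨h0, h1, h2⟩ := h
  have hsrc : b.src = b'.src := by
    funext k
    fin_cases k
    · show b.src 0 = b'.src 0
      have h := ZMod.val_injective _ h0
      calc b.src 0 = (b.src 0 - x₀ 0) + x₀ 0 := by abel
        _ = b'.src 0 := by rw [h]; abel
    · show b.src 1 = b'.src 1
      have h := ZMod.val_injective _ h1
      calc b.src 1 = (b.src 1 - x₀ 1) + x₀ 1 := by abel
        _ = b'.src 1 := by rw [h]; abel
    · show b.src 2 = b'.src 2
      have h := ZMod.val_injective _ h2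
      calc b.src 2 = (b.src 2 - x₀ 2) + x₀ 2 := by abel
        _ = b'.src 2 := by rw [h]; abel
  have hdir : b.dir = b'.dir := by rw [hB b hb, hB b' hb']
  cases b
  cases b'
  simp only at hsrc hdir
  subst hsrc hdir
  rfl

/-- **DIRECTION-1 BONDS OF THE BOX, SQUARED AND SUMMED** (root `r ≤ n − 1`): over any finite set `B` of direction-`1` bonds with both ends in the `ZMod` box,
`Σ_{B} dist₁((U^g)_b)² ≤ n·(n−1)·S₀₁` with `S₀₁` the `(0,1)`-plaquettes of the box counted by integer offsets (each bond's line has `< n` plaquettes —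
Cauchy–Schwarz; the `n` values of `v₀` see the same line). [folklore] -/
theorem sum_sq_dir_one_le (U : GaugeField (F.P K) 0 G) {n : ℕ} (hn : 1 ≤ n) (h2n : 2 * n ≤ (F.P K).sitesPerDir 0) (x₀ : Site (F.P K) 0)
    {r : ℕ} (hr : r ≤ n - 1) (g : GaugeTransf (F.P K) 0 G)
    (hg : ∀ x, (fun k => ((x₀ k).val : ℤ)) ≤ x → x ≤ (fun k => ((x₀ k).val : ℤ) + ((n - 1 : ℕ) : ℤ)) →
      g (castSite x) = axialFn (pull U) ((fun k => ((x₀ k).val : ℤ)) + (r : ℤ) • e 0) x)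
    (B : Finset (PBond (F.P K) 0))
    (hB : ∀ b ∈ B, (∀ k, (b.src k - x₀ k).val < n) ∧ (∀ k, (b.tgt k - x₀ k).val < n) ∧ b.dir = 1) :
    ∑ b ∈ B, dist1 (GaugeField.gaugeAct g U b) ^ 2 ≤
      (n : ℝ) * ((n - 1 : ℕ) : ℝ) * ∑ v₁ ∈ Finset.range (n - 1), ∑ v₂ ∈ Finset.range n, ∑ t ∈ Finset.range (n - 1),
        dist1 (hol (pull U) ((fun k => ((x₀ k).val : ℤ)) + (t : ℤ) • e 0 + (v₁ : ℤ) • e 1 + (v₂ : ℤ) • e 2) (plaqWord 0 1)) ^ 2 := by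
  classical
  set lo : Fin (F.P K).d → ℤ := fun k => ((x₀ k).val : ℤ) with hlo
  set N := n - 1 with hN
  -- the per-bond row
  have key : ∀ b ∈ B, dist1 (GaugeField.gaugeAct g U b) ^ 2 ≤
      (N : ℝ) * ∑ t ∈ Finset.range N, dist1 (hol (pull U) (lo + (t : ℤ) • e 0 + (((b.src 1 - x₀ 1).val : ℕ) : ℤ) • e 1 +
        (((b.src 2 - x₀ 2).val : ℕ) : ℤ) • e 2) (plaqWord 0 1)) ^ 2 := by
    intro b hb
    obtain ⟨hs, ht, hdir⟩ := hB b hb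
    obtain ⟨hv, hvd, hsrc⟩ := bond_coords F K hn h2n x₀ b hs ht
    rw [hdir] at hvd
    have hb_eq : b = ⟨castSite (lo + (((b.src 0 - x₀ 0).val : ℕ) : ℤ) • e 0 + (((b.src 1 - x₀ 1).val : ℕ) : ℤ) • e 1 +
        (((b.src 2 - x₀ 2).val : ℕ) : ℤ) • e 2), 1⟩ := by
      obtain ⟨src, dir⟩ := b
      simp only at hdir hsrc
      subst hdir
      exact congrArg (fun s => (⟨s, 1⟩ : PBond (F.P K) 0)) hsrc
    have h1 := dist1_gaugeAct_one_le F K U lo hr g hg (hv 0) hvd (hv 2)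
    rw [← hb_eq] at h1
    calc dist1 (GaugeField.gaugeAct g U b) ^ 2
        ≤ (∑ t ∈ Finset.range N, dist1 (hol (pull U) (lo + (t : ℤ) • e 0 + (((b.src 1 - x₀ 1).val : ℕ) : ℤ) • e 1 +
            (((b.src 2 - x₀ 2).val : ℕ) : ℤ) • e 2) (plaqWord 0 1))) ^ 2 :=
          pow_le_pow_left₀ (GaugeGroup.dist1_nonneg _) h1 2
      _ ≤ ((Finset.range N).card : ℝ) * _ := sq_sum_le_card_mul_sum_sq
      _ = (N : ℝ) * _ := by rw [Finset.card_range]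
  have hmaps : ∀ b ∈ B, ((b.src 0 - x₀ 0).val, (b.src 1 - x₀ 1).val, (b.src 2 - x₀ 2).val) ∈
      Finset.range n ×ˢ (Finset.range N ×ˢ Finset.range n) := by
    intro b hb
    obtain ⟨hs, ht, hdir⟩ := hB b hb
    obtain ⟨-, hvd, -⟩ := bond_coords F K hn h2n x₀ b hs ht
    rw [hdir] at hvd
    simp only [Finset.mem_product, Finset.mem_range]
    exact ⟨hs 0, by omega, hs 2⟩
  have hinj := injOn_bond_coords F K x₀ B fun b hb => (hB b hb).2.2
  calc ∑ b ∈ B, dist1 (GaugeField.gaugeAct g U b) ^ 2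
      ≤ ∑ b ∈ B, (N : ℝ) * ∑ t ∈ Finset.range N, dist1 (hol (pull U) (lo + (t : ℤ) • e 0 + (((b.src 1 - x₀ 1).val : ℕ) : ℤ) • e 1 +
          (((b.src 2 - x₀ 2).val : ℕ) : ℤ) • e 2) (plaqWord 0 1)) ^ 2 := Finset.sum_le_sum key
    _ = ∑ v ∈ B.image (fun b : PBond (F.P K) 0 => ((b.src 0 - x₀ 0).val, (b.src 1 - x₀ 1).val, (b.src 2 - x₀ 2).val)),
          (N : ℝ) * ∑ t ∈ Finset.range N, dist1 (hol (pull U) (lo + (t : ℤ) • e 0 + (v.2.1 : ℤ) • e 1 + (v.2.2 : ℤ) • e 2) (plaqWord 0 1)) ^ 2 :=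
        (Finset.sum_image (f := fun v : ℕ × ℕ × ℕ => (N : ℝ) * ∑ t ∈ Finset.range N,
          dist1 (hol (pull U) (lo + (t : ℤ) • e 0 + (v.2.1 : ℤ) • e 1 + (v.2.2 : ℤ) • e 2) (plaqWord 0 1)) ^ 2)
          fun x hx y hy h => hinj hx hy h).symm
    _ ≤ ∑ v ∈ Finset.range n ×ˢ (Finset.range N ×ˢ Finset.range n), (N : ℝ) * ∑ t ∈ Finset.range N,
          dist1 (hol (pull U) (lo + (t : ℤ) • e 0 + (v.2.1 : ℤ) • e 1 + (v.2.2 : ℤ) • e 2) (plaqWord 0 1)) ^ 2 :=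
        Finset.sum_le_sum_of_subset_of_nonneg
          (fun v hv => by obtain ⟨b, hb, rfl⟩ := Finset.mem_image.1 hv; exact hmaps b hb)
          fun v _ _ => mul_nonneg (Nat.cast_nonneg _) (Finset.sum_nonneg fun t _ => sq_nonneg _)
    _ = (n : ℝ) * (N : ℝ) * ∑ v₁ ∈ Finset.range N, ∑ v₂ ∈ Finset.range n, ∑ t ∈ Finset.range N,
          dist1 (hol (pull U) (lo + (t : ℤ) • e 0 + (v₁ : ℤ) • e 1 + (v₂ : ℤ) • e 2) (plaqWord 0 1)) ^ 2 := by
        rw [Finset.sum_product]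
        dsimp only
        rw [Finset.sum_const, Finset.card_range, nsmul_eq_mul, Finset.sum_product]
        dsimp only
        simp only [← Finset.mul_sum]
        ring

end Member

end Summit.QuantumFields.YangMills.Theorems.CurvaturePoincareBoxBonds
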